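import Summits.QuantumFields.BalabanUV.Beta.GAN24.HkGradientKingRate
import Summits.QuantumFields.BalabanUV.Beta.GAN24.HkContinuumKernel
import Mathlib.Analysis.MeanInequalitiesPow
import Mathlib.Analysis.SpecialFunctions.Pow.Asymptotics

/-!
# G-an2-4 ∕ (CONV-C), route R7 (ρ3) GRADIENT PART — THE FULL-SEQUENCE RATE `η^{α∕2}` OF THE GRADIENT KERNEL `∂_ν^{(η)}H^{(η)}` OF BAŁABAN's FINE
# MINIMISER AT `U = 1`, EVERY TORUS, BETWEEN ANY TWO SPACINGS (no divisibility), KERNEL CURRENCY WITH DECAY: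
# `‖∂_νH_m((m·ȳ′+⌊m t⌋,μ),(ȳ,λ)) − ∂_νH_n((n·ȳ′+⌊n t⌋,μ),(ȳ,λ))‖ ≤ CDK(d,α)·(n^{−α∕2} + m^{−α∕2})·e^{−dec(d)|y′−y|_T}` (`0 ≤ α < 1`) — PART 1 of 2 of
# INTENT 2 «DHK-CONTINUUM-KERNEL»; PART 2 `HkGradientContinuumKernelLimit` names the `η → 0` gradient kernel and identifies it with `∂_ν` of INTENT 1's `Hc`

G-an2-4 formalisation swarm `b2b-balaban-gan24-formalise-*`, leaf prover 06 (gen 38), crux team (2) under the ruling «YM REDIRECT» (e34b3e0c; FREEZE (0)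
honoured — a `GAN24/` corollary of EXISTING modules, announced statement-first as INTENT 2, journal `HOME/CLAIMS.log` 2026-08-21 l.32403, hold-off honoured,
the road-P2 chair's first refusal).  NOT IN PRINT; OUR BOOKKEEPING over tree theorems BY NAME.  INPUTS: the road-P2 chair gan24-p2 (gen 31)'s GRAD-KING (C)
`HkGradientKingRate.norm_dker_king_sub_le_of_steps` (`(2·CHR(d,α)(h∕N)^α + 2·KH1(d)∕h)·e^{−dec|x′−x|}`, every `1 ≤ h ≤ N∕2`) and `norm_dker_two_levels_le`
(`2·CdecD`); b05's `B5Hk163TorusHolderRate.norm_dker_sub_le_rate` (the decaying `α`-Hölder bound of `∂_νH_k`); `HkContinuumKernel.floor_cells_overlap`.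
WHAT IS PROVED (0 sorry; TWO defs: the bookkeeping `scale n m a := a·m` and the crude constant `CDK d α := 3·CHR(d,α) + 4·KH1(d) + 4·CdecD(d)`):
§0 **`exists_limit_of_pairwise_rate_gen`** (carrier-free: a rate `r` antitone on the positive levels with `r → 0` and `‖u m − u n‖ ≤ K(r n + r m)w` give a
limit with tail `K·r n·w` and `‖u_∞‖ ≤ ‖u 1‖ + K·r 1·w`), the rate `n^{−α∕2}` (`rate_le_rate`, `tendsto_rate`, `le_of_forall_rate`, `rpow_neg_le_rate`,
`rpow_neg_half_le_rate`, `rpow_neg_half_eq`), `update_admissible`; §1 `bpt_eq_bpt_add_toT`, `supNorm_sub_le`, **`norm_dker_bpt_sub_bpt_le`** (in-block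
displacement of `∂_νH_n`: `CHR·(|A − B|_∞∕n)^α·E`, b05 BY NAME, same block twice); §2 `dker_level_congr` (transport along an equality of levels), `sqrt_steps`
(`h = ⌊√N⌋` admissible for `N ≥ 4` with `(h∕N)^α ≤ N^{−α∕2}`, `1∕h ≤ 2N^{−α∕2}`), `scale`, **`norm_dker_refine_sub_le`** (level `n` vs `n·m` at `a·m`:
`(2CHR + 4KH1 + 4CdecD)·n^{−α∕2}·E`), `CDK`, **`norm_dker_sub_of_overlap_le`** (two ARBITRARY levels at overlapping cells: `CDK·(n^{−α∕2} + m^{−α∕2})·E`),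
**`norm_dker_floor_sub_floor_le`** (at the digits of one continuum offset).
HONEST SCOPE.  [folklore] corollary BY NAME + real analysis; `U = 1`; every torus; constants crude, `d`- and `α`-only (`CHR(d,α) ↑ ∞` as `α ↑ 1`); the exponent
`α∕2` is the chair's `h = n_{⌊k∕2⌋}` choice read at `h = ⌊√n⌋` (LK-optimal `α∕(1+α)` not pursued); no `G_k(U)`, no `C^{(k)}`, no general `U`, non-abelian
nothing.  NOT (CONV-C) as typed, NEVER «G-an2-4 closed», NOT NE2 ∕ NE3, NOT D1, NOT BetaPertH, NOT continuum YM, NOT Clay; 0 cite tag, no sorry.  Locators (text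
only): [Balaban1984PropagatorsI] (1.63) p. 28, p. 29 ll. 1–2; [King1986] p. 664; [Balaban1987RG1] p. 264.  HONEST DEPENDENCY: continuum YM on T⁴ ⇐ BetaPertH ∧
nine spine estimates (0/9 proved); BetaPertH ⇐ (D1) ∧ (D4) ∧ CAP+tail; G-an2-4 gates asym, D1 and NE2/3/4.  Provenance: prover-b2b-balaban-gan24-formalise-leaf-06-g38-0
(unit `b2b-balaban-gan24-formalise-leaf-06`, gen 38), 2026-08-21.
-/


noncomputable section

open scoped BigOperators ComplexConjugate Matrix Topology
open Finset

namespace Summit.QuantumFields.BalabanUV.Beta.GAN24.HkGradientContinuumKernel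

open Filter
open Literature.MathematicalPhysics.QuantumFieldTheory.Balaban1983to89
open Literature.MathematicalPhysics.QuantumFieldTheory.Balaban1983to89.B5Prop11Plancherel (Tor fine)
open Literature.MathematicalPhysics.QuantumFieldTheory.Balaban1983to89.B4ContourShift (supNorm supNorm_nonneg abs_le_supNorm)
open Literature.MathematicalPhysics.QuantumFieldTheory.Balaban1983to89.B4TorusKernel (periodConst)
open Literature.MathematicalPhysics.QuantumFieldTheory.Balaban1983to89.B4TorusKernel.MultiPeriod (torusSupNorm)
open Literature.MathematicalPhysics.QuantumFieldTheory.Balaban1983to89.B5Block118 (bpt iota up)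
open Literature.MathematicalPhysics.QuantumFieldTheory.Balaban1983to89.B6LowerBound2153Torus (toT rep toT_rep)
open Literature.MathematicalPhysics.QuantumFieldTheory.Balaban1983to89.B5Hk163Strip (kappa163 kappa163_pos)
open Literature.MathematicalPhysics.QuantumFieldTheory.Balaban1983to89.B5Hk163Torus (hker HkOp)
open Literature.MathematicalPhysics.QuantumFieldTheory.Balaban1983to89.B5Hk163TorusHolder (dker)
open Literature.MathematicalPhysics.QuantumFieldTheory.Balaban1983to89.B5Hk163TorusHolderDecay (CdecD CdecD_nonneg norm_dker_bpt_le)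
open Literature.MathematicalPhysics.QuantumFieldTheory.Balaban1983to89.B5Hk163TorusHolderRate (CHR CHR_nonneg norm_dker_sub_le_rate)
open Summit.QuantumFields.BalabanUV.Beta.GAN24.HkKingOneStep (dec dec_pos KH1 KH1_nonneg)
open Summit.QuantumFields.BalabanUV.Beta.GAN24.HkGradientKingRate (dec_eq norm_dker_king_sub_le_of_steps norm_dker_two_levels_le)
open Summit.QuantumFields.BalabanUV.Beta.GAN24.HkContinuumKernel (floor_cells_overlap)

variable {d : ℕ}

/-! ## §0 Carrier-free: a pairwise rate `K·(r n + r m)·w` with `r` antitone, `r → 0`; the rate `n^{−α∕2}` -/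

section Generic

variable {E : Type*} [NormedAddCommGroup E] [CompleteSpace E]

/-- **THE LIMIT OF A LEVEL FAMILY WITH A GENERAL PAIRWISE RATE** (carrier-free; the `r = n⁻¹` case is `HkContinuumKernel.exists_limit_of_pairwise_rate`):
if `r` is antitone on the levels `≥ 1` and tends to `0`, and `‖u m − u n‖ ≤ K·(r n + r m)·w` for all `n, m ≥ 1` (`K, w ≥ 0`), then there is `u_∞` with
`u (k+1) → u_∞`, `‖u n − u_∞‖ ≤ K·r n·w` for every `n ≥ 1`, and `‖u_∞‖ ≤ ‖u 1‖ + K·r 1·w`. [folklore] -/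
theorem exists_limit_of_pairwise_rate_gen (u : (n : ℕ) → [NeZero n] → E) {K w : ℝ} (hK : 0 ≤ K) (hw : 0 ≤ w) (r : ℕ → ℝ)
    (hr : ∀ n m : ℕ, 1 ≤ n → n ≤ m → r m ≤ r n) (hr0 : Tendsto r atTop (𝓝 0))
    (h : ∀ (n m : ℕ) [NeZero n] [NeZero m], ‖u m - u n‖ ≤ K * (r n + r m) * w) :
    ∃ uinf : E, Tendsto (fun k : ℕ => u (k + 1)) atTop (𝓝 uinf) ∧
      (∀ (n : ℕ) [NeZero n], ‖u n - uinf‖ ≤ K * r n * w) ∧ ‖uinf‖ ≤ ‖u 1‖ + K * r 1 * w := by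
  set v : ℕ → E := fun k => u (k + 1) with hv
  have hr1 : Tendsto (fun k : ℕ => r (k + 1)) atTop (𝓝 0) := hr0.comp (tendsto_add_atTop_nat 1)
  have hKw : 0 ≤ K * w := mul_nonneg hK hw
  have hcau : CauchySeq v := by
    refine cauchySeq_of_le_tendsto_0 (fun N : ℕ => K * (r (N + 1) + r (N + 1)) * w) (fun n m N hn hm => ?_) ?_
    · rw [dist_eq_norm, ← norm_neg, neg_sub]
      refine (h (n + 1) (m + 1)).trans ?_
      have hn' : r (n + 1) ≤ r (N + 1) := hr _ _ (Nat.succ_le_succ (Nat.zero_le N)) (Nat.add_le_add_right hn 1)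
      have hm' : r (m + 1) ≤ r (N + 1) := hr _ _ (Nat.succ_le_succ (Nat.zero_le N)) (Nat.add_le_add_right hm 1)
      calc K * (r (n + 1) + r (m + 1)) * w = (r (n + 1) + r (m + 1)) * (K * w) := by ring
        _ ≤ (r (N + 1) + r (N + 1)) * (K * w) := mul_le_mul_of_nonneg_right (add_le_add hn' hm') hKw
        _ = K * (r (N + 1) + r (N + 1)) * w := by ring
    · simpa using ((hr1.add hr1).const_mul K).mul_const w
  obtain ⟨uinf, huinf⟩ := cauchySeq_tendsto_of_complete hcau
  have htail : ∀ (n : ℕ) [NeZero n], ‖u n - uinf‖ ≤ K * r n * w := by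
    intro n _
    have hg : Tendsto (fun m : ℕ => ‖u n - v m‖) atTop (𝓝 ‖u n - uinf‖) := (tendsto_const_nhds.sub huinf).norm
    have hb : Tendsto (fun m : ℕ => K * (r (m + 1) + r n) * w) atTop (𝓝 (K * (0 + r n) * w)) :=
      ((hr1.add tendsto_const_nhds).const_mul K).mul_const w
    rw [zero_add] at hb
    exact le_of_tendsto_of_tendsto' hg hb fun m => h (m + 1) n
  refine ⟨uinf, huinf, htail, ?_⟩
  calc ‖uinf‖ = ‖u 1 - (u 1 - uinf)‖ := by rw [sub_sub_cancel]
    _ ≤ ‖u 1‖ + ‖u 1 - uinf‖ := norm_sub_le _ _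
    _ ≤ ‖u 1‖ + K * r 1 * w := add_le_add le_rfl (htail 1)

end Generic

/-- the rate `n^{−α∕2}` is antitone on the positive levels (`0 ≤ α`). [folklore] -/
theorem rate_le_rate {α : ℝ} (hα0 : 0 ≤ α) (n m : ℕ) (hn : 1 ≤ n) (hnm : n ≤ m) :
    (m : ℝ) ^ (-(α / 2)) ≤ (n : ℝ) ^ (-(α / 2)) :=
  Real.rpow_le_rpow_of_nonpos (by exact_mod_cast hn) (by exact_mod_cast hnm) (by linarith)

/-- the rate `n^{−α∕2}` tends to `0` (`0 < α`). [folklore] -/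
theorem tendsto_rate {α : ℝ} (hα : 0 < α) : Tendsto (fun n : ℕ => (n : ℝ) ^ (-(α / 2))) atTop (𝓝 0) :=
  (tendsto_rpow_neg_atTop (half_pos hα)).comp tendsto_natCast_atTop_atTop

/-- if `x ≤ C·n^{−α∕2} + D` for every level `n ≥ 1` (`0 < α`), then `x ≤ D`. [folklore] -/
theorem le_of_forall_rate {x C D α : ℝ} (hα : 0 < α) (h : ∀ (n : ℕ) [NeZero n], x ≤ C * (n : ℝ) ^ (-(α / 2)) + D) : x ≤ D := by
  have hlim : Tendsto (fun k : ℕ => C * (((k + 1 : ℕ) : ℝ)) ^ (-(α / 2)) + D) atTop (𝓝 (C * 0 + D)) :=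
    (((tendsto_rate hα).comp (tendsto_add_atTop_nat 1)).const_mul C).add_const D
  rw [mul_zero, zero_add] at hlim
  exact ge_of_tendsto hlim (Eventually.of_forall fun k => h (k + 1))

/-- the offset moved by `σ` in direction `ν` stays admissible. [folklore] -/
theorem update_admissible (t : Fin (d + 1) → ℝ) (ht0 : ∀ i, 0 ≤ t i) (ht1 : ∀ i, t i < 1) (ν : Fin (d + 1)) {σ : ℝ} (hσ : 0 ≤ σ)
    (hσ1 : t ν + σ < 1) : (∀ i, 0 ≤ Function.update t ν (t ν + σ) i) ∧ (∀ i, Function.update t ν (t ν + σ) i < 1) := by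
  refine ⟨fun i => ?_, fun i => ?_⟩ <;> by_cases hi : i = ν
  · subst hi; rw [Function.update_self]; linarith [ht0 i]
  · rw [Function.update_of_ne hi]; exact ht0 i
  · subst hi; rw [Function.update_self]; exact hσ1
  · rw [Function.update_of_ne hi]; exact ht1 i

/-- `n^{−α} ≤ n^{−α∕2}` for `n ≥ 1`, `0 ≤ α`. [folklore] -/
theorem rpow_neg_le_rate {α : ℝ} (hα0 : 0 ≤ α) (n : ℕ) [NeZero n] : (n : ℝ) ^ (-α) ≤ (n : ℝ) ^ (-(α / 2)) :=
  Real.rpow_le_rpow_of_exponent_le (by exact_mod_cast Nat.pos_of_ne_zero (NeZero.ne n)) (by linarith)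

/-- `n^{−1∕2} ≤ n^{−α∕2}` for `n ≥ 1`, `α ≤ 1`. [folklore] -/
theorem rpow_neg_half_le_rate {α : ℝ} (hα1 : α ≤ 1) (n : ℕ) [NeZero n] : (n : ℝ) ^ (-(1 / 2 : ℝ)) ≤ (n : ℝ) ^ (-(α / 2)) :=
  Real.rpow_le_rpow_of_exponent_le (by exact_mod_cast Nat.pos_of_ne_zero (NeZero.ne n)) (by linarith)

/-- `n^{−1∕2} = (√n)⁻¹`. [folklore] -/
theorem rpow_neg_half_eq (n : ℕ) : (n : ℝ) ^ (-(1 / 2 : ℝ)) = (Real.sqrt n)⁻¹ := by rw [Real.rpow_neg (Nat.cast_nonneg n), Real.sqrt_eq_rpow]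

/-! ## §1 In-block displacement of the GRADIENT kernel (b05's decaying Hölder bound, same block twice) -/

section Displacement

variable (n : ℕ) [NeZero n] (M : Fin (d + 1) → ℕ) [hM : ∀ μ, NeZero (M μ)]

omit [NeZero n] hM in
/-- two offsets of one block differ by the torus image of their integer difference: `n·ȳ + A = (n·ȳ + B) + toT (A − B)`. [folklore] -/
theorem bpt_eq_bpt_add_toT (y : Tor M) (A B : Fin (d + 1) → Fin n) :
    bpt n M y A = bpt n M y B + toT (fine n M) (fun i => ((A i : ℕ) : ℤ) - ((B i : ℕ) : ℤ)) := by
  funext i; simp only [bpt, iota, toT, Pi.add_apply]; push_cast; ring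

omit [NeZero n] hM in
/-- the sup norm of an integer offset difference is controlled entrywise. [folklore] -/
theorem supNorm_sub_le (A B : Fin (d + 1) → Fin n) {S : ℝ} (h : ∀ i, |(((A i : ℕ) : ℝ)) - ((B i : ℕ) : ℝ)| ≤ S) :
    supNorm (fun i => ((A i : ℕ) : ℤ) - ((B i : ℕ) : ℤ)) ≤ S := by
  unfold supNorm
  refine Finset.sup'_le _ _ fun i _ => ?_
  have hi := h i
  show (((|((A i : ℕ) : ℤ) - ((B i : ℕ) : ℤ)| : ℤ)) : ℝ) ≤ S
  rw [Int.cast_abs]; push_cast; exact hi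

/-- **in-block displacement of `∂_νH_n`**: for any two offsets `A, B ∈ (Fin n)^{d+1}` of the block `ȳ′`,
`‖∂_νH_n((n·ȳ′+A,μ),(ȳ,λ)) − ∂_νH_n((n·ȳ′+B,μ),(ȳ,λ))‖ ≤ CHR(d,α)·(|A − B|_∞∕n)^α·e^{−dec(d)·|y′−y|_T}` (`0 ≤ α < 1`) —
`B5Hk163TorusHolderRate.norm_dker_sub_le_rate` with both points in the same block (`max_self`). [folklore] -/
theorem norm_dker_bpt_sub_bpt_le (μ lam ν : Fin (d + 1)) (x' x : Fin (d + 1) → ℤ) (A B : Fin (d + 1) → Fin n) {α : ℝ} (hα0 : 0 ≤ α)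
    (hα1 : α < 1) :
    ‖dker n M μ lam ν (bpt n M (toT M x') A) (toT M x) - dker n M μ lam ν (bpt n M (toT M x') B) (toT M x)‖
      ≤ CHR d α * (supNorm (fun i => ((A i : ℕ) : ℤ) - ((B i : ℕ) : ℤ)) / n) ^ α * Real.exp (-(dec d * torusSupNorm M (x' - x))) := by
  have h := norm_dker_sub_le_rate n M μ lam ν x' x' x B A (fun i => ((A i : ℕ) : ℤ) - ((B i : ℕ) : ℤ))
    (bpt_eq_bpt_add_toT n M (toT M x') A B) hα0 hα1
  rwa [max_self, ← dec_eq] at h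

end Displacement

/-! ## §2 Two ARBITRARY levels at overlapping fine cells: through the common refinement `n·m` -/

section TwoLevels

variable (M : Fin (d + 1) → ℕ) [hM : ∀ μ, NeZero (M μ)]

/-- transport of a `∂_νH` entry along an equality of levels (the offset is re-typed by `Fin.cast`). [folklore] -/
theorem dker_level_congr {L L' : ℕ} [NeZero L] [NeZero L'] (e : L = L') (μ lam ν : Fin (d + 1)) (y : Tor M)
    (A : Fin (d + 1) → Fin L) (z : Tor M) :
    dker L' M μ lam ν (bpt L' M y (fun i => Fin.cast e (A i))) z = dker L M μ lam ν (bpt L M y A) z := by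
  subst e; rfl

omit hM in
/-- **the admissible secant length `h = ⌊√N⌋` for `N ≥ 4`**: `1 ≤ h`, `2h ≤ N`, `(h∕N)^α ≤ N^{−α∕2}` and `1∕h ≤ 2·N^{−α∕2}` (`0 ≤ α ≤ 1`). [folklore] -/
theorem sqrt_steps (N : ℕ) (hN : 4 ≤ N) {α : ℝ} (hα0 : 0 ≤ α) (hα1 : α ≤ 1) :
    1 ≤ Nat.sqrt N ∧ 2 * Nat.sqrt N ≤ N ∧ ((Nat.sqrt N : ℝ) / N) ^ α ≤ (N : ℝ) ^ (-(α / 2)) ∧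
      (1 : ℝ) / Nat.sqrt N ≤ 2 * (N : ℝ) ^ (-(α / 2)) := by
  set h := Nat.sqrt N with hh
  have h2 : 2 ≤ h := Nat.le_sqrt'.mpr (by norm_num; omega)
  have hsq : h ^ 2 ≤ N := Nat.sqrt_le' N
  have hlt : N < (h + 1) ^ 2 := Nat.lt_succ_sqrt' N
  have hN0 : (0 : ℝ) < N := by exact_mod_cast (show 0 < N by omega)
  have hh0 : (0 : ℝ) < h := by exact_mod_cast (show 0 < h by omega)
  haveI : NeZero N := ⟨by omega⟩
  refine ⟨by omega, by nlinarith, ?_, ?_⟩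
  · -- (h/N)^α ≤ (N^{-1/2})^α = N^{-α/2}
    have hsqR : (h : ℝ) ≤ Real.sqrt N := by
      rw [Real.le_sqrt hh0.le hN0.le]
      exact_mod_cast (by simpa [pow_two] using hsq)
    have hle : (h : ℝ) / N ≤ (N : ℝ) ^ (-(1 / 2 : ℝ)) := by
      rw [rpow_neg_half_eq, div_le_iff₀ hN0]
      calc (h : ℝ) ≤ Real.sqrt N := hsqR
        _ = (Real.sqrt N)⁻¹ * N := by
            rw [eq_inv_mul_iff_mul_eq₀ (Real.sqrt_pos.mpr hN0).ne', Real.mul_self_sqrt hN0.le]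
    calc ((h : ℝ) / N) ^ α ≤ ((N : ℝ) ^ (-(1 / 2 : ℝ))) ^ α := Real.rpow_le_rpow (by positivity) hle hα0
      _ = (N : ℝ) ^ (-(α / 2)) := by rw [← Real.rpow_mul hN0.le]; ring_nf
  · -- 1/h ≤ 2/√N ≤ 2 N^{-α/2}
    have hlt' : Real.sqrt N < h + 1 := by
      rw [Real.sqrt_lt' (by positivity)]
      exact_mod_cast (by simpa [pow_two] using hlt)
    have h1 : (1 : ℝ) / h ≤ 2 * (Real.sqrt N)⁻¹ := by
      have h2R : (2 : ℝ) ≤ h := by exact_mod_cast h2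
      have step1 : (1 : ℝ) / h ≤ 2 / ((h : ℝ) + 1) := by
        rw [div_le_div_iff₀ hh0 (by positivity)]; linarith
      have step2 : (2 : ℝ) / ((h : ℝ) + 1) ≤ 2 / Real.sqrt N :=
        div_le_div_of_nonneg_left (by norm_num) (Real.sqrt_pos.mpr hN0) hlt'.le
      calc (1 : ℝ) / h ≤ 2 / ((h : ℝ) + 1) := step1
        _ ≤ 2 / Real.sqrt N := step2
        _ = 2 * (Real.sqrt N)⁻¹ := div_eq_mul_inv _ _
    calc (1 : ℝ) / h ≤ 2 * (Real.sqrt N)⁻¹ := h1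
      _ = 2 * (N : ℝ) ^ (-(1 / 2 : ℝ)) := by rw [rpow_neg_half_eq]
      _ ≤ 2 * (N : ℝ) ^ (-(α / 2)) := by
          have := rpow_neg_half_le_rate hα1 N
          linarith

/-- the scaled offset `a·m` of level `n·m` (same physical position as `a` at level `n`; King's parent digit at `R = m` is `a`). [folklore] -/
def scale (n m : ℕ) [NeZero m] (a : Fin (d + 1) → Fin n) : Fin (d + 1) → Fin (n * m) :=
  fun i => ⟨(a i : ℕ) * m, Nat.mul_lt_mul_of_pos_right (a i).isLt (Nat.pos_of_ne_zero (NeZero.ne m))⟩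

omit hM in
/-- `(scale a)_i = a_i · m`. [folklore] -/
@[simp] theorem scale_val (n m : ℕ) [NeZero m] (a : Fin (d + 1) → Fin n) (i : Fin (d + 1)) : ((scale n m a i : ℕ)) = (a i : ℕ) * m := rfl

/-- **LEVEL `n` AGAINST ITS REFINEMENT `n·m` AT THE SCALED OFFSET** (`0 ≤ α < 1`, every `n, m ≥ 1`, every torus):
`‖∂_νH_{nm}((nm·ȳ′+a·m,μ),(ȳ,λ)) − ∂_νH_n((n·ȳ′+a,μ),(ȳ,λ))‖ ≤ (2·CHR(d,α) + 4·KH1(d) + 4·CdecD(d))·n^{−α∕2}·e^{−dec|y′−y|_T}` — the chair's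
`norm_dker_king_sub_le_of_steps` at `(N, R, h) = (n, m, ⌊√n⌋)` for `n ≥ 4` (King's parent digit of `a·m` is `a`), `norm_dker_two_levels_le` for `n ≤ 3`
(`2·CdecD ≤ 4·CdecD·n^{−α∕2}` there). [folklore] -/
theorem norm_dker_refine_sub_le {n m : ℕ} [NeZero n] [NeZero m] (μ lam ν : Fin (d + 1)) (x' x : Fin (d + 1) → ℤ)
    (a : Fin (d + 1) → Fin n) {α : ℝ} (hα0 : 0 ≤ α) (hα1 : α < 1) :
    ‖dker (n * m) M μ lam ν (bpt (n * m) M (toT M x') (scale n m a)) (toT M x) - dker n M μ lam ν (bpt n M (toT M x') a) (toT M x)‖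
      ≤ (2 * CHR d α + 4 * KH1 d + 4 * CdecD d) * (n : ℝ) ^ (-(α / 2)) * Real.exp (-(dec d * torusSupNorm M (x' - x))) := by
  have hn : 1 ≤ n := Nat.pos_of_ne_zero (NeZero.ne n)
  have hm : 0 < m := Nat.pos_of_ne_zero (NeZero.ne m)
  set E := Real.exp (-(dec d * torusSupNorm M (x' - x))) with hE
  have hE0 : 0 < E := Real.exp_pos _
  have hCHR := CHR_nonneg (d := d) α
  have hKH1 := KH1_nonneg d
  have hCd := CdecD_nonneg (d := d)
  have hrate0 : 0 < (n : ℝ) ^ (-(α / 2)) := Real.rpow_pos_of_pos (by exact_mod_cast hn) _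
  -- the level-`mn` avatar of the scaled offset, and the parent relation
  set a' : Fin (d + 1) → Fin (m * n) := fun i => Fin.cast (Nat.mul_comm n m) (scale n m a i) with ha'
  have hpar : ∀ i, (a' i : ℕ) / m = (a i : ℕ) := fun i => by
    simp only [ha', Fin.val_cast, scale_val]; exact Nat.mul_div_cancel _ hm
  have hcongr : dker (m * n) M μ lam ν (bpt (m * n) M (toT M x') a') (toT M x)
      = dker (n * m) M μ lam ν (bpt (n * m) M (toT M x') (scale n m a)) (toT M x) :=
    dker_level_congr M (Nat.mul_comm n m) μ lam ν (toT M x') (scale n m a) (toT M x)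
  rw [← hcongr]
  by_cases h4 : 4 ≤ n
  · obtain ⟨hh1, hh2, hr1, hr2⟩ := sqrt_steps n h4 hα0 hα1.le
    have key := norm_dker_king_sub_le_of_steps (N := n) (R := m) M μ lam ν x' x a a' hpar hh1 hh2 hα0 hα1
    refine key.trans ?_
    have hstep : 2 * CHR d α * ((Nat.sqrt n : ℝ) / n) ^ α + 2 * KH1 d / Nat.sqrt n
        ≤ (2 * CHR d α + 4 * KH1 d + 4 * CdecD d) * (n : ℝ) ^ (-(α / 2)) := by
      have h1 : 2 * CHR d α * ((Nat.sqrt n : ℝ) / n) ^ α ≤ 2 * CHR d α * (n : ℝ) ^ (-(α / 2)) :=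
        mul_le_mul_of_nonneg_left hr1 (by positivity)
      have h2 : 2 * KH1 d / Nat.sqrt n ≤ 2 * KH1 d * (2 * (n : ℝ) ^ (-(α / 2))) := by
        rw [div_eq_mul_one_div]
        exact mul_le_mul_of_nonneg_left hr2 (by positivity)
      nlinarith
    exact mul_le_mul_of_nonneg_right hstep hE0.le
  · have key := norm_dker_two_levels_le (N := n) (R := m) M μ lam ν x' x a a'
    refine key.trans ?_
    -- `n ≤ 3`: `n^{-α/2} ≥ n^{-1/2} ≥ 1/2`
    have hn4 : (n : ℝ) ≤ 4 := by exact_mod_cast (by omega)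
    have hsqrt0 : 0 < Real.sqrt n := Real.sqrt_pos.mpr (by exact_mod_cast hn)
    have hsqrt : Real.sqrt n ≤ 2 := by
      rw [show (2 : ℝ) = Real.sqrt 4 by
        rw [show (4 : ℝ) = 2 ^ 2 by norm_num, Real.sqrt_sq (by norm_num : (0:ℝ) ≤ 2)]]
      exact Real.sqrt_le_sqrt hn4
    have hhalf : (1 : ℝ) / 2 ≤ (n : ℝ) ^ (-(α / 2)) := by
      refine le_trans ?_ (rpow_neg_half_le_rate hα1.le n)
      rw [rpow_neg_half_eq, one_div]
      exact inv_anti₀ hsqrt0 hsqrt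
    have h0 : 0 ≤ (2 * CHR d α + 4 * KH1 d) * (n : ℝ) ^ (-(α / 2)) := by positivity
    calc 2 * CdecD d * E = 4 * CdecD d * (1 / 2) * E := by ring
      _ ≤ 4 * CdecD d * (n : ℝ) ^ (-(α / 2)) * E :=
          mul_le_mul_of_nonneg_right (mul_le_mul_of_nonneg_left hhalf (by positivity)) hE0.le
      _ ≤ (2 * CHR d α + 4 * KH1 d + 4 * CdecD d) * (n : ℝ) ^ (-(α / 2)) * E := by
          refine mul_le_mul_of_nonneg_right ?_ hE0.le
          nlinarith

/-- **THE CRUDE CONSTANT of the two-level gradient law**: `CDK(d,α) := 3·CHR(d,α) + 4·KH1(d) + 4·CdecD(d)`. OURS. [folklore] -/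
def CDK (d : ℕ) (α : ℝ) : ℝ := 3 * CHR d α + 4 * KH1 d + 4 * CdecD d

omit hM in
/-- `0 ≤ CDK d α`. [folklore] -/
theorem CDK_nonneg (d : ℕ) (α : ℝ) : 0 ≤ CDK d α := by
  have := CHR_nonneg (d := d) α; have := KH1_nonneg d; have := CdecD_nonneg (d := d)
  unfold CDK; positivity

/-- **TWO ARBITRARY LEVELS AT OVERLAPPING FINE CELLS — THE GRADIENT KERNEL, `U = 1`, EVERY TORUS**: for levels `n, m ≥ 1` (no divisibility),
`0 ≤ α < 1`, unit points `ȳ′, ȳ`, components `μ, λ`, a direction `ν`, and offsets `a ∈ (Fin n)^{d+1}`, `a′ ∈ (Fin m)^{d+1}` whose fine cells overlap in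
every direction (`a_i·m < (a′_i+1)·n ∧ a′_i·n < (a_i+1)·m`):
`‖∂_νH_m((m·ȳ′+a′,μ),(ȳ,λ)) − ∂_νH_n((n·ȳ′+a,μ),(ȳ,λ))‖ ≤ CDK(d,α)·(n^{−α∕2} + m^{−α∕2})·e^{−dec(d)·|y′−y|_T}`.
Mechanism: both entries are compared with the common refinement `n·m` at the scaled offsets `a·m`, `a′·n` (`norm_dker_refine_sub_le` twice, the
second through `dker_level_congr` along `m·n = n·m`), and the two scaled offsets differ by `< max(n,m) ≤ n + m` fine steps of level `n·m` per direction,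
costing `CHR·((n+m)∕(nm))^α ≤ CHR·(n^{−α} + m^{−α}) ≤ CHR·(n^{−α∕2} + m^{−α∕2})` (§1, `Real.rpow_add_le_add_rpow`). [folklore] -/
theorem norm_dker_sub_of_overlap_le {n m : ℕ} [NeZero n] [NeZero m] (μ lam ν : Fin (d + 1)) (x' x : Fin (d + 1) → ℤ)
    (a : Fin (d + 1) → Fin n) (a' : Fin (d + 1) → Fin m)
    (hover : ∀ i, (a i : ℕ) * m < ((a' i : ℕ) + 1) * n ∧ (a' i : ℕ) * n < ((a i : ℕ) + 1) * m) {α : ℝ} (hα0 : 0 ≤ α) (hα1 : α < 1) :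
    ‖dker m M μ lam ν (bpt m M (toT M x') a') (toT M x) - dker n M μ lam ν (bpt n M (toT M x') a) (toT M x)‖
      ≤ CDK d α * ((n : ℝ) ^ (-(α / 2)) + (m : ℝ) ^ (-(α / 2))) * Real.exp (-(dec d * torusSupNorm M (x' - x))) := by
  have hn : 1 ≤ n := Nat.pos_of_ne_zero (NeZero.ne n)
  have hm : 1 ≤ m := Nat.pos_of_ne_zero (NeZero.ne m)
  have hn0 : (0 : ℝ) < n := by exact_mod_cast hn
  have hm0 : (0 : ℝ) < m := by exact_mod_cast hm
  set E := Real.exp (-(dec d * torusSupNorm M (x' - x))) with hE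
  have hE0 : 0 < E := Real.exp_pos _
  have hCHR := CHR_nonneg (d := d) α
  have hKH1 := KH1_nonneg d
  have hCd := CdecD_nonneg (d := d)
  have hrn : 0 < (n : ℝ) ^ (-(α / 2)) := Real.rpow_pos_of_pos hn0 _
  have hrm : 0 < (m : ℝ) ^ (-(α / 2)) := Real.rpow_pos_of_pos hm0 _
  -- the two scaled offsets at level `n·m`
  set A : Fin (d + 1) → Fin (n * m) := scale n m a with hA
  set A' : Fin (d + 1) → Fin (n * m) := fun i => Fin.cast (Nat.mul_comm m n) (scale m n a' i) with hA'
  -- (1) level `n` vs `n·m` at `A`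
  have h1 := norm_dker_refine_sub_le M μ lam ν x' x a hα0 hα1 (m := m)
  -- (2) level `m` vs `m·n` at `a′·n`, transported to level `n·m`
  have h2 : ‖dker (n * m) M μ lam ν (bpt (n * m) M (toT M x') A') (toT M x) - dker m M μ lam ν (bpt m M (toT M x') a') (toT M x)‖
      ≤ (2 * CHR d α + 4 * KH1 d + 4 * CdecD d) * (m : ℝ) ^ (-(α / 2)) * E := by
    rw [hA', dker_level_congr M (Nat.mul_comm m n) μ lam ν (toT M x') (scale m n a') (toT M x)]
    exact norm_dker_refine_sub_le M μ lam ν x' x a' hα0 hα1 (m := n)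
  -- (3) the displacement at level `n·m`
  have hdiff : ∀ i, |(((A i : ℕ) : ℝ)) - ((A' i : ℕ) : ℝ)| ≤ (n : ℝ) + m := by
    intro i
    obtain ⟨hl, hr⟩ := hover i
    have hl' : ((a i : ℕ) : ℝ) * m < (((a' i : ℕ) : ℝ) + 1) * n := by exact_mod_cast hl
    have hr' : ((a' i : ℕ) : ℝ) * n < (((a i : ℕ) : ℝ) + 1) * m := by exact_mod_cast hr
    have eA : ((A i : ℕ) : ℝ) = ((a i : ℕ) : ℝ) * m := by rw [hA, scale_val]; push_cast; ring
    have eA' : ((A' i : ℕ) : ℝ) = ((a' i : ℕ) : ℝ) * n := by rw [hA', Fin.val_cast, scale_val]; push_cast; ring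
    rw [eA, eA', abs_le]
    constructor <;> nlinarith
  have hsup : supNorm (fun i => ((A i : ℕ) : ℤ) - ((A' i : ℕ) : ℤ)) ≤ (n : ℝ) + m := supNorm_sub_le (n * m) A A' hdiff
  have h3 := norm_dker_bpt_sub_bpt_le (n * m) M μ lam ν x' x A A' hα0 hα1
  have h3' : ‖dker (n * m) M μ lam ν (bpt (n * m) M (toT M x') A) (toT M x) - dker (n * m) M μ lam ν (bpt (n * m) M (toT M x') A') (toT M x)‖
      ≤ CHR d α * ((n : ℝ) ^ (-(α / 2)) + (m : ℝ) ^ (-(α / 2))) * E := by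
    refine h3.trans (mul_le_mul_of_nonneg_right (mul_le_mul_of_nonneg_left ?_ hCHR) hE0.le)
    -- (|A − A′|_∞ / (nm))^α ≤ ((n+m)/(nm))^α = (n⁻¹ + m⁻¹)^α ≤ n^{-α} + m^{-α} ≤ n^{-α/2} + m^{-α/2}
    have hnm0 : (0 : ℝ) < ((n * m : ℕ) : ℝ) := by push_cast; positivity
    have hq0 : 0 ≤ supNorm (fun i => ((A i : ℕ) : ℤ) - ((A' i : ℕ) : ℤ)) / ((n * m : ℕ) : ℝ) :=
      div_nonneg (supNorm_nonneg _) hnm0.le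
    have hq : supNorm (fun i => ((A i : ℕ) : ℤ) - ((A' i : ℕ) : ℤ)) / ((n * m : ℕ) : ℝ) ≤ (n : ℝ)⁻¹ + (m : ℝ)⁻¹ := by
      rw [div_le_iff₀ hnm0]
      refine hsup.trans (le_of_eq ?_)
      push_cast; field_simp; ring
    calc (supNorm (fun i => ((A i : ℕ) : ℤ) - ((A' i : ℕ) : ℤ)) / ((n * m : ℕ) : ℝ)) ^ α
        ≤ ((n : ℝ)⁻¹ + (m : ℝ)⁻¹) ^ α := Real.rpow_le_rpow hq0 hq hα0
      _ ≤ ((n : ℝ)⁻¹) ^ α + ((m : ℝ)⁻¹) ^ α :=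
          Real.rpow_add_le_add_rpow (inv_nonneg.mpr hn0.le) (inv_nonneg.mpr hm0.le) hα0 hα1.le
      _ = (n : ℝ) ^ (-α) + (m : ℝ) ^ (-α) := by
          rw [Real.inv_rpow hn0.le, Real.inv_rpow hm0.le, Real.rpow_neg hn0.le, Real.rpow_neg hm0.le]
      _ ≤ (n : ℝ) ^ (-(α / 2)) + (m : ℝ) ^ (-(α / 2)) := add_le_add (rpow_neg_le_rate hα0 n) (rpow_neg_le_rate hα0 m)
  -- triangle
  set P := dker m M μ lam ν (bpt m M (toT M x') a') (toT M x) with hP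
  set Q := dker n M μ lam ν (bpt n M (toT M x') a) (toT M x) with hQ
  set RA := dker (n * m) M μ lam ν (bpt (n * m) M (toT M x') A) (toT M x) with hRA
  set RA' := dker (n * m) M μ lam ν (bpt (n * m) M (toT M x') A') (toT M x) with hRA'
  have htri : ‖P - Q‖ ≤ ‖RA' - P‖ + ‖RA - RA'‖ + ‖RA - Q‖ :=
    calc ‖P - Q‖ = ‖(RA - Q) - (RA - RA') - (RA' - P)‖ := by congr 1; abel
      _ ≤ ‖(RA - Q) - (RA - RA')‖ + ‖RA' - P‖ := norm_sub_le _ _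
      _ ≤ ‖RA - Q‖ + ‖RA - RA'‖ + ‖RA' - P‖ := add_le_add (norm_sub_le _ _) le_rfl
      _ = ‖RA' - P‖ + ‖RA - RA'‖ + ‖RA - Q‖ := by ring
  refine htri.trans ((add_le_add (add_le_add h2 h3') h1).trans (le_of_eq ?_))
  rw [CDK]; ring

/-- **THE GRADIENT `η`-RATE CAUCHY ESTIMATE AT A CONTINUUM OFFSET**: at the digit vectors `a = ⌊n t⌋`, `a′ = ⌊m t⌋` of one offset `t ≥ 0`
(hypotheses `ha`, `ha′`), `‖∂_νH_m(…a′…) − ∂_νH_n(…a…)‖ ≤ CDK(d,α)·(n^{−α∕2} + m^{−α∕2})·e^{−dec|y′−y|_T}` — i.e.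
`‖∂^{(η)}H^{(η)} − ∂^{(η′)}H^{(η′)}‖ ≤ CDK·(η^{α∕2} + η′^{α∕2})·e^{−dec|·|}` read at one continuum point. [folklore] -/
theorem norm_dker_floor_sub_floor_le {n m : ℕ} [NeZero n] [NeZero m] (μ lam ν : Fin (d + 1)) (x' x : Fin (d + 1) → ℤ)
    (t : Fin (d + 1) → ℝ) (ht : ∀ i, 0 ≤ t i) (a : Fin (d + 1) → Fin n) (a' : Fin (d + 1) → Fin m)
    (ha : ∀ i, (a i : ℕ) = ⌊(n : ℝ) * t i⌋₊) (ha' : ∀ i, (a' i : ℕ) = ⌊(m : ℝ) * t i⌋₊) {α : ℝ} (hα0 : 0 ≤ α) (hα1 : α < 1) :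
    ‖dker m M μ lam ν (bpt m M (toT M x') a') (toT M x) - dker n M μ lam ν (bpt n M (toT M x') a) (toT M x)‖
      ≤ CDK d α * ((n : ℝ) ^ (-(α / 2)) + (m : ℝ) ^ (-(α / 2))) * Real.exp (-(dec d * torusSupNorm M (x' - x))) :=
  norm_dker_sub_of_overlap_le M μ lam ν x' x a a' (fun i => by
    rw [ha i, ha' i]
    exact floor_cells_overlap (Nat.pos_of_ne_zero (NeZero.ne n)) (Nat.pos_of_ne_zero (NeZero.ne m)) (ht i)) hα0 hα1

end TwoLevels

end Summit.QuantumFields.BalabanUV.Beta.GAN24.HkGradientContinuumKernel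

end
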